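/-
Copyright (c) 2026 the pub-hodgecm-mathlib formalisation cell (harness21).  Prover seat hodgecm-mathlib-LH4-p01 (g12): road M6 → F5 → dyadic chain of `stub_DyUnramCore` (D-UNR),
site (L2-3) «THE WALL», CM-carrier row 3 «N3-θ TRANSPORT» of CENSUS-L23-CM v1 (LH10-p01 (g12)); 2026-09-03.
-/
import Literature.NumberTheory.Automorphic.LevelTwoInteriorOrbitalTransport        -- ★ N3 p846692 (F0P2-p01 (g14)): the σ-fixed pair (pattern); §2 `isIntMatrix_inv_smul_conj_sub_one_iff`, `isClosed_setOf_levelOne`; brings ★ N2′, ★ FILE 1, the unfolding kit, ★ (A3)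
import Literature.NumberTheory.Rogawski1990.FinExplicitTransferFactorHermitianShiftSum  -- ★ p853684 (this seat) (A3)-θ: `isUnit_det_hermitianShift_denominators_of_isLocalNormPair`; brings ★ p853677 «CM-SHIFT-θ» (`coe_endoEmbLocal∕isLocalNormPair_of_coe_eq_genMoebius`) + ★ p853671 (`map_genMoebius`)
import Literature.NumberTheory.Automorphic.ResidualHermitianShiftRank               -- ★ p853688 (this seat) R-θ: `valuation_det_one_add_smul_eq_one`, `pow∕rank_redMat_sub_one_…_of_hermitianShift`
import Literature.NumberTheory.Automorphic.TypeTwoHermitianMoebiusShiftFrame        -- ★ P3 p853657 (LH10-p01 (g12)): `hermitianMoebius_one_add_smul_eq` (`φ_θ(1 + c•X) = (1 + θ•X)(1 + (c−σθ)•X)⁻¹`)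
import Literature.NumberTheory.Automorphic.MatrixHermitianMoebiusShiftOrder         -- ★ P4 p853652 (LH10-p01 (g12)): `hermitianMoebius_mem_adjoin`, `hermitianMoebius_inv_mem_adjoin`, `mem_adjoin_hermitianMoebius` (the shifted order, no `2`)
import HarnessLib

/-!
# Level-two interior orbital transport along the HERMITIAN Cayley shift: `Φ(⟦x⟧, 1_{x_w ≡ 1 (ϖ)}·g) = Φ(⟦φ_θ x⟧, g′)` at every residue characteristic (organ (I) N3-θ;
# Rogawski 1990 §4.9, Kottwitz 1986 §3)

Topic `NumberTheory/Automorphic`; namespace `Literature.NumberTheory.Automorphic`.  THEOREMS ONLY (no definition, no instance, no notation, no named fact, no `sorry`); kernel lane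
`--supports stmt-HodgeConjecture-24833`.  Cell `pub/hodgecm-mathlib` (D-0151), crux H413 = `stmt-HodgeConjecture-24833`; road M6 → F5 → the dyadic chain of organ (D-UNR)
`stub_DyUnramCore`, LEVEL TWO, site (L2-3) «THE WALL» = ★ `liftInterior_of_levelTwo` with `h2` deleted; CM-carrier ROW 3 of LH10-p01 (g12)'s CENSUS-L23-CM v1 (call sites ★
`LevelTwoLiftInterior` :318, :412).  ★ N3 `classOrbitalIntegral_levelOneIndicator_eq_shift` transports the interior orbital integral along the σ-FIXED shift `φ_c` under
`|2|_w = 1` (the `E_v`-denominators `det(2·1 + (c∓1)W)`, the shifted order ★ N2′ via ★ α `mem_adjoin_moebius (h2)`, and the residual rank `red M − 1 = 2Ā(2 − Ā)⁻¹`).  THIS FILE is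
★ N3 token for token with the HERMITIAN shift `φ_θ = (θ•_ + (c−θ)•1)((c−σθ)•_ + σθ•1)⁻¹` (`σ = conjLocal`, `θ + σθ = 1`, `|θ_w| ≤ 1`; LEAD T15-55 fence «`φ_θ` everywhere»):
* §1 `isUnit_det_hermitianShift_denominators_of_deep`: for a 2-deep `γ_H` the `E_v`-level denominators `det((c−σθ)•ι + σθ•1) = c_w³·det(1 + (c_w−σθ_w)W)` and
  `det(θ•ι + (c−θ)•1) = c_w³·det(1 + θ_w W)` are units (`W = c_w⁻¹(ι_w − 1) ≡ 0 (c_w)`, ★ `v_det_eq_one_of_forall_v_sub_one_lt_one`) — NO `|2|`;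
* §2 `hermitianShifted_order_memberships_of_deep` (twin of ★ N2′ `shifted_order_memberships_of_deep`): `φ_θ(δ)_w, φ_θ(δ)_w⁻¹ ∈ 𝒪_w[X_δ]`, `X_δ ∈ 𝒪_w[φ_θ(δ)_w]`,
  `X_δ = 1 + c_w⁻¹(δ_w − 1)` — ★ P4 `hermitianMoebius_mem_adjoin ∕ …_inv_mem_adjoin ∕ mem_adjoin_hermitianMoebius` (units `1 − c_w`, `c_w − σθ_w` instead of `2`, `c_w − 1`;
  `|σθ_w| = 1` because `θ_w + σθ_w = 1`), transported along the match by ★ `conj_mem_adjoin_of_mem_adjoin`, ★ P1 `moebius_conj'`;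
* §3 HEAD **`classOrbitalIntegral_levelOneIndicator_eq_hermitianShift`** = ★ N3 :199 with `(h2 : |2|_w = 1)` ↦ `(θ) (hθ : θ + σθ = 1) (hθv : |θ_w| ≤ 1)` and the shift binders
  `h1 h2′ hD1 hD2 hy` in the `φ_θ` shape; proof = ★'s verbatim over §1∕§2, ★ p853677∕p853684 (matching, `ι∘φ = φ∘ι`, class-function denominators), ★ P3
  `hermitianMoebius_one_add_smul_eq` and ★ R-θ `pow∕rank_redMat_sub_one_eq_…_of_hermitianShift` (`red((q⁻¹yq)_w) − 1 = N̄(1 − σθ̄_w N̄)⁻¹`).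
HONEST LABEL: HC_CM is proved only modulo the 7 printed citations (2 remaining: hLiu418 = stmt-HodgeConjecture-24832, h413 = stmt-HodgeConjecture-24833) until rung 0 closes;
count-neutral CM glue (zero label movement; L2-3 stays THE WALL until rows 2∕5∕7 + the (I) assembly are paid); nothing printed is asserted here.

## References
* [Rogawski1990] J. D. Rogawski, *Automorphic Representations of Unitary Groups in Three Variables*, Ann. of Math. Stud. 123 (1990), §4.9 Prop. 4.9.1 p. 55; §4.3 (4.3.1) p. 43.
* [Kottwitz1986BaseChangeUnits] R. E. Kottwitz, *Base change for unit elements of Hecke algebras*, Compositio Math. 60 (1986), §2 pp. 244–247, §3.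
* [Laumon1995] G. Laumon, *Cohomology of Drinfeld Modular Varieties* I (1996), Lemma (5.3.2) p. 136.
* [Serre1980Trees] J.-P. Serre, *Trees* (1980), Ch. II §1.1–1.2.
-/

set_option autoImplicit false

noncomputable section

open NumberField IsDedekindDomain Matrix Polynomial MeasureTheory Measure Topology Filter
open scoped MatrixGroups WithZero Valued

namespace Literature.NumberTheory.Automorphic

open UnitaryGroup Literature.NumberTheory.Rogawski1990 Literature.NumberTheory.Automorphic.MoebiusShift Literature.NumberTheory.Automorphic.IntegralReduction
  Literature.NumberTheory.Automorphic.UnitaryLatticeTree Literature.NumberTheory.GaloisRepresentations Literature.NumberTheory.NumberFields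

/-! ## §1 The `E_v`-level hermitian denominators of a 2-deep `γ_H` are units (no `|2|`) -/

/-- **The denominators `det((c−σθ)•ι_v(γ_H) + σθ•1)` and `det(θ•ι_v(γ_H) + (c−θ)•1)` are units of `E_v`** for a 2-deep `γ_H` at a non-split place, `θ + σθ = 1`, `|θ_w| ≤ 1`: at
`w` they read `c_w³·det(1 + t·W)` with `W = c_w⁻¹(ι_w − 1) ≡ 0 (mod c_w)`, `|t| ≤ 1`, and `E_v = L_w` has one factor.  ★ `isUnit_det_shift_denominators_of_deep` is the σ-fixed pair
under `|2|_w = 1`. [cite: Kottwitz1986BaseChangeUnits, §3] [cite: Rogawski1990, §4.9 Prop. 4.9.1 (b) p. 55] -/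
theorem isUnit_det_hermitianShift_denominators_of_deep (L : Type) [Field L] [NumberField L] [IsCMField L]
    {v : HeightOneSpectrum (𝓞 ↥(maximalRealSubfield L))} (w : UnitaryGroup.PlacesOver L v) (hw : IsCMField.complexConj L • w.1 = w.1)
    (γH : (cmDatum L 2 (Matrix.of fun i j : Fin 2 => if i.val + j.val + 1 = 2 then (1 : L) else 0)).Local v ×
      (cmDatum L 1 (Matrix.of fun i j : Fin 1 => if i.val + j.val + 1 = 1 then (1 : L) else 0)).Local v)
    {c : LocalRing L v} (hc : Valued.v (c w) = WithZero.exp (-1 : ℤ))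
    {θ : LocalRing L v} (hθ : θ + conjLocal L (IsCMField.complexConj L) v θ = 1) (hθv : Valued.v (θ w) ≤ 1)
    (hdeep : ∀ i j, Valued.v (((((endoEmbLocal L v γH).val : GL (Fin 3) (LocalRing L v)).val.map (Pi.evalRingHom (fun w' : UnitaryGroup.PlacesOver L v => w'.1.adicCompletion L) w)) - 1) i j) ≤ Valued.v (c w) ^ 2) :
    IsUnit ((c - conjLocal L (IsCMField.complexConj L) v θ) • ((((endoEmbLocal L v γH).val : GL (Fin 3) (LocalRing L v)).val : Matrix (Fin 3) (Fin 3) (LocalRing L v))) + conjLocal L (IsCMField.complexConj L) v θ • (1 : Matrix (Fin 3) (Fin 3) (LocalRing L v))).det ∧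
      IsUnit (θ • ((((endoEmbLocal L v γH).val : GL (Fin 3) (LocalRing L v)).val : Matrix (Fin 3) (Fin 3) (LocalRing L v))) + (c - θ) • (1 : Matrix (Fin 3) (Fin 3) (LocalRing L v))).det := by
  have hv : Subsingleton (UnitaryGroup.PlacesOver L v) := PlacesOver.subsingleton_of_smul_eq (IsCMField.complexConj L) (IsCMField.complexConj_ne_one L) w hw
  set evw : LocalRing L v →+* w.1.adicCompletion L := (Pi.evalRingHom (fun w' : UnitaryGroup.PlacesOver L v => w'.1.adicCompletion L) w) with hevw
  set cw : w.1.adicCompletion L := c w with hcw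
  set θw : w.1.adicCompletion L := θ w with hθw
  set θ'w : w.1.adicCompletion L := (conjLocal L (IsCMField.complexConj L) v θ) w with hθ'w
  set ιw : Matrix (Fin 3) (Fin 3) (w.1.adicCompletion L) := (((endoEmbLocal L v γH).val : GL (Fin 3) (LocalRing L v)).val.map evw) with hιw
  obtain ⟨hc0, hc1, -, -, -, -⟩ := shift_parameter_facts hc
  have hsum : θw + θ'w = 1 := by
    have h := congrArg (fun f : LocalRing L v => f w) hθ
    simpa only [Pi.add_apply, Pi.one_apply] using h
  have hθ'v : Valued.v θ'w ≤ 1 := by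
    rw [show θ'w = 1 - θw by linear_combination hsum]
    exact (Valuation.map_sub _ _ _).trans (max_le (by rw [map_one]) hθv)
  have hct : Valued.v (cw - θ'w) ≤ 1 := (Valuation.map_sub _ _ _).trans (max_le hc1.le hθ'v)
  set W : Matrix (Fin 3) (Fin 3) (w.1.adicCompletion L) := cw⁻¹ • (ιw - 1) with hW
  have hιW : ιw = 1 + cw • W := eq_one_add_smul_inv_smul_sub_one hc0 ιw
  clear_value W
  have hWc : ∀ i j, Valued.v (W i j) ≤ Valued.v cw := by
    intro i j
    rw [hW, Matrix.smul_apply, smul_eq_mul, map_mul, map_inv₀]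
    have hvc0 : Valued.v cw ≠ 0 := (Valuation.ne_zero_iff _).2 hc0
    calc (Valued.v cw)⁻¹ * Valued.v ((ιw - 1) i j) ≤ (Valued.v cw)⁻¹ * Valued.v cw ^ 2 := mul_le_mul_right (hdeep i j) _
      _ = Valued.v cw := by rw [sq, ← mul_assoc, inv_mul_cancel₀ hvc0, one_mul]
  have hdet : ∀ {t : w.1.adicCompletion L}, Valued.v t ≤ 1 → Valued.v ((1 : Matrix (Fin 3) (Fin 3) (w.1.adicCompletion L)) + t • W).det = 1 := by
    intro t ht
    have hM : ∀ i k, Valued.v ((((1 : Matrix (Fin 3) (Fin 3) (w.1.adicCompletion L)) + t • W) - 1) i k) < 1 := fun i k => by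
      rw [add_sub_cancel_left, Matrix.smul_apply, smul_eq_mul, map_mul]
      calc Valued.v t * Valued.v (W i k) ≤ 1 * Valued.v cw := mul_le_mul' ht (hWc i k)
        _ < 1 := by rw [one_mul]; exact hc1
    exact v_det_eq_one_of_forall_v_sub_one_lt_one _ hM
  -- reading a denominator of `ι_v(γ_H)` at `w`
  have hread : ∀ a b : LocalRing L v, ((a • ((((endoEmbLocal L v γH).val : GL (Fin 3) (LocalRing L v)).val : Matrix (Fin 3) (Fin 3) (LocalRing L v))) + b • (1 : Matrix (Fin 3) (Fin 3) (LocalRing L v))).det) w = (a w • ιw + b w • (1 : Matrix (Fin 3) (Fin 3) (w.1.adicCompletion L))).det := fun a b => by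
    have e0 : ((a • ((((endoEmbLocal L v γH).val : GL (Fin 3) (LocalRing L v)).val : Matrix (Fin 3) (Fin 3) (LocalRing L v))) + b • (1 : Matrix (Fin 3) (Fin 3) (LocalRing L v))).det) w = evw ((a • ((((endoEmbLocal L v γH).val : GL (Fin 3) (LocalRing L v)).val : Matrix (Fin 3) (Fin 3) (LocalRing L v))) + b • (1 : Matrix (Fin 3) (Fin 3) (LocalRing L v))).det) := rfl
    rw [e0, RingHom.map_det, RingHom.mapMatrix_apply, map_smul_add_smul_one]
    rfl
  have hne : ∀ {x : LocalRing L v}, Valued.v (x w) = Valued.v cw ^ 3 → IsUnit x := fun {x} hx =>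
    isUnit_localRing_of_ne_zero_of_subsingleton L v hv fun h0 => by
      rw [h0, Pi.zero_apply, map_zero] at hx
      exact pow_ne_zero 3 ((Valuation.ne_zero_iff _).2 hc0) hx.symm
  refine ⟨hne ?_, hne ?_⟩
  · rw [hread, show (c - conjLocal L (IsCMField.complexConj L) v θ) w = cw - θ'w from rfl, show (conjLocal L (IsCMField.complexConj L) v θ) w = θ'w from rfl, hιW,
      smul_one_add_smul_add_smul_one_of_add_eq W cw (cw - θ'w) θ'w (by ring), Matrix.det_smul, Fintype.card_fin, map_mul, map_pow, hdet hct, mul_one]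
  · rw [hread, show θ w = θw from rfl, show (c - θ) w = cw - θw from rfl, hιW,
      smul_one_add_smul_add_smul_one_of_add_eq W cw θw (cw - θw) (by ring), Matrix.det_smul, Fintype.card_fin, map_mul, map_pow, hdet hθv, mul_one]

/-! ## §2 The shifted order memberships of `φ_θ(δ)` for a 2-deep `γ_H` (twin of ★ N2′) -/

set_option maxHeartbeats 1600000 in
-- the carriers' types are large (same budget as ★ N2′)
/-- **N2′-θ «THE HERMITIAN-SHIFTED ORDER MEMBERSHIPS, TYPE-FREE, ANY RESIDUE CHARACTERISTIC»**: at a non-split place (`σ • w = w`), for a 2-DEEP `γ_H`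
(`ι_v(γ_H)_w ≡ 1 (mod c_w²)` entrywise, `|c_w| = exp(−1)`), `θ + σθ = 1` with `|θ_w| ≤ 1`, a match `δ` of `γ_H` and `δ′` with matrix `φ_θ(δ)`: with `Y := (δ′)_w`,
`X_δ := 1 + c_w⁻¹((δ)_w − 1)`: `Y ∈ 𝒪_w[X_δ]`, `Y⁻¹ ∈ 𝒪_w[X_δ]`, `X_δ ∈ 𝒪_w[Y]` — the `hu hu′ hX` of ★ p846407 `sum_fixedBy_interior_eq_sum_fixedBy_cayley_relabel`.  Proof = ★ N2′'s
with `N± = 2·1 + (c_w ± 1)W` ↦ `1 + θ_w W`, `1 + (c_w − σθ_w)W` (unit determinants by `W ≡ 0 (c_w)`), ★ α §4 ↦ ★ P4 (units `1 − c_w`, `c_w − σθ_w`; `|σθ_w| = 1`), ★ α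
`moebius_conj` ↦ ★ P1 `moebius_conj'`, `φ(ι_w) = Y₀` by ★ P3 `hermitianMoebius_one_add_smul_eq`. [cite: Kottwitz1986BaseChangeUnits, §2 pp. 244–247, §3]
[cite: Rogawski1990, §4.9 Prop. 4.9.1 (b) p. 55] [cite: Serre1980Trees, Ch. II §1.1–1.2] -/
theorem hermitianShifted_order_memberships_of_deep (L : Type) [Field L] [NumberField L] [IsCMField L] (H' : Matrix (Fin 3) (Fin 3) L)
    {v : HeightOneSpectrum (𝓞 ↥(maximalRealSubfield L))} (w : UnitaryGroup.PlacesOver L v) (hw : IsCMField.complexConj L • w.1 = w.1)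
    (γH : (cmDatum L 2 (Matrix.of fun i j : Fin 2 => if i.val + j.val + 1 = 2 then (1 : L) else 0)).Local v ×
      (cmDatum L 1 (Matrix.of fun i j : Fin 1 => if i.val + j.val + 1 = 1 then (1 : L) else 0)).Local v)
    (δ δ' : (cmDatum L 3 H').Local v)
    {c : LocalRing L v} (hc : Valued.v (c w) = WithZero.exp (-1 : ℤ))
    {θ : LocalRing L v} (hθ : θ + conjLocal L (IsCMField.complexConj L) v θ = 1) (hθv : Valued.v (θ w) ≤ 1)
    (hdeep : ∀ i j, Valued.v (((((endoEmbLocal L v γH).val : GL (Fin 3) (LocalRing L v)).val.map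
        (Pi.evalRingHom (fun w' : UnitaryGroup.PlacesOver L v => w'.1.adicCompletion L) w)) - 1) i j) ≤ Valued.v (c w) ^ 2)
    (h : IsLocalNormPair L H' v γH δ)
    (hδ : ((δ'.val : GL (Fin 3) (LocalRing L v)).val : Matrix (Fin 3) (Fin 3) (LocalRing L v)) =
      (θ • ((δ.val : GL (Fin 3) (LocalRing L v)).val : Matrix (Fin 3) (Fin 3) (LocalRing L v)) + (c - θ) • 1) *
        ((c - conjLocal L (IsCMField.complexConj L) v θ) • ((δ.val : GL (Fin 3) (LocalRing L v)).val : Matrix (Fin 3) (Fin 3) (LocalRing L v)) + conjLocal L (IsCMField.complexConj L) v θ • 1)⁻¹) :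
    ((δ'.val : GL (Fin 3) (LocalRing L v)).val.map (Pi.evalRingHom (fun w' : UnitaryGroup.PlacesOver L v => w'.1.adicCompletion L) w)) ∈
        Algebra.adjoin 𝒪[w.1.adicCompletion L] ({1 + (c w)⁻¹ • (((δ.val : GL (Fin 3) (LocalRing L v)).val.map
          (Pi.evalRingHom (fun w' : UnitaryGroup.PlacesOver L v => w'.1.adicCompletion L) w)) - 1)} : Set (Matrix (Fin 3) (Fin 3) (w.1.adicCompletion L))) ∧
      ((δ'.val : GL (Fin 3) (LocalRing L v)).val.map (Pi.evalRingHom (fun w' : UnitaryGroup.PlacesOver L v => w'.1.adicCompletion L) w))⁻¹ ∈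
        Algebra.adjoin 𝒪[w.1.adicCompletion L] ({1 + (c w)⁻¹ • (((δ.val : GL (Fin 3) (LocalRing L v)).val.map
          (Pi.evalRingHom (fun w' : UnitaryGroup.PlacesOver L v => w'.1.adicCompletion L) w)) - 1)} : Set (Matrix (Fin 3) (Fin 3) (w.1.adicCompletion L))) ∧
      (1 + (c w)⁻¹ • (((δ.val : GL (Fin 3) (LocalRing L v)).val.map (Pi.evalRingHom (fun w' : UnitaryGroup.PlacesOver L v => w'.1.adicCompletion L) w)) - 1)) ∈
        Algebra.adjoin 𝒪[w.1.adicCompletion L] ({((δ'.val : GL (Fin 3) (LocalRing L v)).val.map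
          (Pi.evalRingHom (fun w' : UnitaryGroup.PlacesOver L v => w'.1.adicCompletion L) w))} : Set (Matrix (Fin 3) (Fin 3) (w.1.adicCompletion L))) := by
  have hv : Subsingleton (UnitaryGroup.PlacesOver L v) := PlacesOver.subsingleton_of_smul_eq (IsCMField.complexConj L) (IsCMField.complexConj_ne_one L) w hw
  set evw : LocalRing L v →+* w.1.adicCompletion L := Pi.evalRingHom (fun w' : UnitaryGroup.PlacesOver L v => w'.1.adicCompletion L) w with hevw
  set O : Subring (w.1.adicCompletion L) := 𝒪[w.1.adicCompletion L] with hOdef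
  have hO : ∀ {z : w.1.adicCompletion L}, z ∈ O ↔ Valued.v z ≤ 1 := fun {z} => Valuation.mem_integer_iff _ _
  set cw : w.1.adicCompletion L := c w with hcw
  set θw : w.1.adicCompletion L := θ w with hθw
  set θ'w : w.1.adicCompletion L := (conjLocal L (IsCMField.complexConj L) v θ) w with hθ'w
  set ιw : Matrix (Fin 3) (Fin 3) (w.1.adicCompletion L) := (((endoEmbLocal L v γH).val : GL (Fin 3) (LocalRing L v)).val.map evw) with hιw
  set δw : Matrix (Fin 3) (Fin 3) (w.1.adicCompletion L) := ((δ.val : GL (Fin 3) (LocalRing L v)).val.map evw) with hδw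
  obtain ⟨hc0, hc1, -, -, -, -⟩ := shift_parameter_facts hc
  -- the pair at `w`: `θ_w + θ′_w = 1`, `|θ′_w| = 1`, `|c_w − θ′_w| = 1`, `|1 − c_w| = 1`
  have hsum : θw + θ'w = 1 := by
    have h := congrArg (fun f : LocalRing L v => f w) hθ
    simpa only [Pi.add_apply, Pi.one_apply] using h
  have hθ'e : θ'w = 1 - θw := by linear_combination hsum
  have hθ'v : Valued.v θ'w ≤ 1 := by rw [hθ'e]; exact (Valuation.map_sub _ _ _).trans (max_le (by rw [map_one]) hθv)
  -- `σ_w` is an isometry, so `|θ′_w| = |θ_w| = 1` and `|c_w − θ′_w| = 1` (★ P3 `valued_map_eq_one_of_add_map_eq_one`)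
  haveI : Algebra.IsQuadraticExtension ↥(maximalRealSubfield L) L := IsCMField.isQuadraticExtension L
  set σw := galAdicCompletionMap (L := L) (IsCMField.complexConj L) hw with hσw
  have hθ'σ : θ'w = σw θw := conjLocal_apply_eq_of_smul_eq (IsCMField.complexConj L) (IsCMField.complexConj_ne_one L) v w hw θ
  have hsum' : θw + σw θw = 1 := by rw [← hθ'σ]; exact hsum
  obtain ⟨hσθ1, -, hcσ⟩ := valued_map_eq_one_of_add_map_eq_one σw (fun z => valued_galAdicCompletionMap L (IsCMField.complexConj L) hw z) hθv hsum'
  have hct1 : Valued.v (cw - θ'w) = 1 := by rw [hθ'σ]; exact hcσ hc1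
  have h1c : Valued.v (1 - cw) = 1 := by
    rw [Valuation.map_sub_eq_of_lt_left _ (show Valued.v cw < Valued.v (1 : w.1.adicCompletion L) by rw [map_one]; exact hc1), map_one]
  have hct : Valued.v (cw - θ'w) ≤ 1 := hct1.le
  -- `W = c_w⁻¹(ι_w − 1)`, `ι_w = 1 + c_w W`, and 2-deepness: `|W_{ij}| ≤ |c_w| < 1`
  set W : Matrix (Fin 3) (Fin 3) (w.1.adicCompletion L) := cw⁻¹ • (ιw - 1) with hW
  have hιW : ιw = 1 + cw • W := eq_one_add_smul_inv_smul_sub_one hc0 ιw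
  clear_value W
  have hWc : ∀ i j, Valued.v (W i j) ≤ Valued.v cw := by
    intro i j
    rw [hW, Matrix.smul_apply, smul_eq_mul, map_mul, map_inv₀]
    have hdij := hdeep i j
    have hvc0 : Valued.v cw ≠ 0 := (Valuation.ne_zero_iff _).2 hc0
    calc (Valued.v cw)⁻¹ * Valued.v ((ιw - 1) i j) ≤ (Valued.v cw)⁻¹ * Valued.v cw ^ 2 := mul_le_mul_right hdij _
      _ = Valued.v cw := by rw [sq, ← mul_assoc, inv_mul_cancel₀ hvc0, one_mul]
  have hWi : ∀ i j, Valued.v (W i j) ≤ 1 := fun i j => (hWc i j).trans hc1.le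
  have hWO : ∀ i j, W i j ∈ O := fun i j => hO.2 (hWi i j)
  have hcO : cw ∈ O := hO.2 hc1.le
  have hθO : θw ∈ O := hO.2 hθv
  have hθ'O : θ'w ∈ O := hO.2 hθ'v
  have htO : cw - θ'w ∈ O := O.sub_mem hcO hθ'O
  -- the determinants of `Np = 1 + θ_w W`, `Nm = 1 + (c_w − θ′_w)W` are units (`tW ≡ 0 (mod 𝔪)`, ★ `v_det_eq_one_of_forall_v_sub_one_lt_one`) — no `2`
  have hdet : ∀ {t : w.1.adicCompletion L}, Valued.v t ≤ 1 →
      Valued.v ((1 : w.1.adicCompletion L) • (1 : Matrix (Fin 3) (Fin 3) (w.1.adicCompletion L)) + t • W).det = 1 := by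
    intro t ht
    rw [one_smul]
    have hM : ∀ i k, Valued.v ((((1 : Matrix (Fin 3) (Fin 3) (w.1.adicCompletion L)) + t • W) - 1) i k) < 1 := fun i k => by
      rw [add_sub_cancel_left, Matrix.smul_apply, smul_eq_mul, map_mul]
      calc Valued.v t * Valued.v (W i k) ≤ 1 * Valued.v cw := mul_le_mul' ht (hWc i k)
        _ < 1 := by rw [one_mul]; exact hc1
    exact v_det_eq_one_of_forall_v_sub_one_lt_one _ hM
  have hunit : ∀ {z : w.1.adicCompletion L}, Valued.v z = 1 → ∃ d ∈ O, d * z = 1 := fun {z} hz => by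
    have hz0 : z ≠ 0 := fun h0 => by rw [h0, map_zero] at hz; exact zero_ne_one hz
    exact ⟨z⁻¹, hO.2 (by rw [map_inv₀, hz, inv_one]), inv_mul_cancel₀ hz0⟩
  have hm : ∃ d ∈ O, d * ((1 : w.1.adicCompletion L) • (1 : Matrix (Fin 3) (Fin 3) (w.1.adicCompletion L)) + (cw - θ'w) • W).det = 1 := hunit (hdet hct)
  have hp : ∃ d ∈ O, d * ((1 : w.1.adicCompletion L) • (1 : Matrix (Fin 3) (Fin 3) (w.1.adicCompletion L)) + θw • W).det = 1 := hunit (hdet hθv)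
  have h1cO : ∃ e ∈ O, e * (1 - cw) = 1 := hunit h1c
  have hctO : ∃ e ∈ O, e * (cw - θ'w) = 1 := hunit hct1
  -- ★ P4: the order identity for `W`
  set Y₀ : Matrix (Fin 3) (Fin 3) (w.1.adicCompletion L) := ((1 : w.1.adicCompletion L) • (1 : Matrix (Fin 3) (Fin 3) (w.1.adicCompletion L)) + θw • W) *
    ((1 : w.1.adicCompletion L) • (1 : Matrix (Fin 3) (Fin 3) (w.1.adicCompletion L)) + (cw - θ'w) • W)⁻¹ with hY₀
  have hY₀mem : Y₀ ∈ Algebra.adjoin O ({W} : Set (Matrix (Fin 3) (Fin 3) (w.1.adicCompletion L))) := hermitianMoebius_mem_adjoin O hWO hθO htO hm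
  have hY₀inv : Y₀⁻¹ ∈ Algebra.adjoin O ({W} : Set (Matrix (Fin 3) (Fin 3) (w.1.adicCompletion L))) := hermitianMoebius_inv_mem_adjoin O hWO hθO htO hm hp
  have hWmem : W ∈ Algebra.adjoin O ({Y₀} : Set (Matrix (Fin 3) (Fin 3) (w.1.adicCompletion L))) := mem_adjoin_hermitianMoebius O hWO hθO hθ'O hcO hsum h1cO hctO hm
  -- the match: `δ_w = x_w ι_w x_w⁻¹`
  obtain ⟨x, hx⟩ := isConj_iff.1 h
  have hxdet : IsUnit (((x : GL (Fin 3) (LocalRing L v)) : Matrix (Fin 3) (Fin 3) (LocalRing L v)).map evw).det := by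
    rw [← RingHom.mapMatrix_apply, ← RingHom.map_det]; exact (Matrix.isUnits_det_units x).map _
  set P : GL (Fin 3) (w.1.adicCompletion L) := Matrix.nonsingInvUnit _ hxdet with hP
  have hPv : (P : Matrix (Fin 3) (Fin 3) (w.1.adicCompletion L)) = ((x : GL (Fin 3) (LocalRing L v)) : Matrix (Fin 3) (Fin 3) (LocalRing L v)).map evw := rfl
  have hPi : ((P⁻¹ : GL (Fin 3) (w.1.adicCompletion L)) : Matrix (Fin 3) (Fin 3) (w.1.adicCompletion L)) = (((x : GL (Fin 3) (LocalRing L v)) : Matrix (Fin 3) (Fin 3) (LocalRing L v)).map evw)⁻¹ := by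
    rw [Matrix.coe_units_inv, hPv]
  have hmx : ((δ.val : GL (Fin 3) (LocalRing L v)).val : Matrix (Fin 3) (Fin 3) (LocalRing L v)) =
      (x : GL (Fin 3) (LocalRing L v)).val * (((endoEmbLocal L v γH).val : GL (Fin 3) (LocalRing L v)).val) * (x⁻¹ : GL (Fin 3) (LocalRing L v)).val := by
    rw [← hx, Units.val_mul, Units.val_mul]; rfl
  have hδconj : δw = (P : Matrix (Fin 3) (Fin 3) (w.1.adicCompletion L)) * ιw * ((P⁻¹ : GL (Fin 3) (w.1.adicCompletion L)) : Matrix (Fin 3) (Fin 3) (w.1.adicCompletion L)) := by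
    rw [hδw, hmx, Matrix.map_mul, Matrix.map_mul, Matrix.coe_units_inv, map_nonsing_inv_of_isUnit evw _ (Matrix.isUnits_det_units x), hPi, hPv]
  -- `φ_θ(δ)_w = P·Y₀·P⁻¹` and `X_δ = P(1 + W)P⁻¹`
  have hNu : IsUnit ((1 : w.1.adicCompletion L) • (1 : Matrix (Fin 3) (Fin 3) (w.1.adicCompletion L)) + (cw - θ'w) • W).det := by
    obtain ⟨d, -, hd⟩ := hm; exact IsUnit.of_mul_eq_one_right d hd
  have hNu' : IsUnit ((1 : Matrix (Fin 3) (Fin 3) (w.1.adicCompletion L)) + (cw - θ'w) • W).det := by rw [← one_smul (w.1.adicCompletion L) (1 : Matrix (Fin 3) (Fin 3) (w.1.adicCompletion L))]; exact hNu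
  have hDι : IsUnit ((cw - θ'w) • ιw + θ'w • (1 : Matrix (Fin 3) (Fin 3) (w.1.adicCompletion L))).det := by
    rw [hιW, smul_one_add_smul_add_smul_one_of_add_eq W cw (cw - θ'w) θ'w (by ring), Matrix.det_smul]
    exact (IsUnit.pow _ (isUnit_iff_ne_zero.2 hc0)).mul hNu'
  have hφι : (θw • ιw + (cw - θw) • (1 : Matrix (Fin 3) (Fin 3) (w.1.adicCompletion L))) * ((cw - θ'w) • ιw + θ'w • (1 : Matrix (Fin 3) (Fin 3) (w.1.adicCompletion L)))⁻¹ = Y₀ := by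
    rw [hιW, hermitianMoebius_one_add_smul_eq W hc0 θw θ'w hNu', hY₀, one_smul]
  -- the `E_v`-level denominator of `δ` is a unit (one place above `v`; its `w`-component is `det P · (c_w³ det Nm) · det P⁻¹`)
  have hDδ : IsUnit ((c - conjLocal L (IsCMField.complexConj L) v θ) • ((δ.val : GL (Fin 3) (LocalRing L v)).val : Matrix (Fin 3) (Fin 3) (LocalRing L v)) + conjLocal L (IsCMField.complexConj L) v θ • (1 : Matrix (Fin 3) (Fin 3) (LocalRing L v))).det := by
    refine isUnit_localRing_of_ne_zero_of_subsingleton L v hv fun h0 => ?_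
    have hw0 := congrFun h0 w
    have e1 : (((c - conjLocal L (IsCMField.complexConj L) v θ) • ((δ.val : GL (Fin 3) (LocalRing L v)).val : Matrix (Fin 3) (Fin 3) (LocalRing L v)) + conjLocal L (IsCMField.complexConj L) v θ • (1 : Matrix (Fin 3) (Fin 3) (LocalRing L v))).det) w =
        ((cw - θ'w) • δw + θ'w • (1 : Matrix (Fin 3) (Fin 3) (w.1.adicCompletion L))).det := by
      have e0 : (((c - conjLocal L (IsCMField.complexConj L) v θ) • ((δ.val : GL (Fin 3) (LocalRing L v)).val : Matrix (Fin 3) (Fin 3) (LocalRing L v)) + conjLocal L (IsCMField.complexConj L) v θ • (1 : Matrix (Fin 3) (Fin 3) (LocalRing L v))).det) w =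
          evw (((c - conjLocal L (IsCMField.complexConj L) v θ) • ((δ.val : GL (Fin 3) (LocalRing L v)).val : Matrix (Fin 3) (Fin 3) (LocalRing L v)) + conjLocal L (IsCMField.complexConj L) v θ • (1 : Matrix (Fin 3) (Fin 3) (LocalRing L v))).det) := rfl
      rw [e0, RingHom.map_det, RingHom.mapMatrix_apply, map_smul_add_smul_one]
      rfl
    rw [e1, Pi.zero_apply, hδconj, smul_units_conj_add_smul_one P ιw (cw - θ'w) θ'w, Matrix.det_units_conj] at hw0
    exact hDι.ne_zero hw0
  have hYw : ((δ'.val : GL (Fin 3) (LocalRing L v)).val.map evw) = (P : Matrix (Fin 3) (Fin 3) (w.1.adicCompletion L)) * Y₀ * ((P⁻¹ : GL (Fin 3) (w.1.adicCompletion L)) : Matrix (Fin 3) (Fin 3) (w.1.adicCompletion L)) := by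
    rw [hδ, map_genMoebius evw _ _ _ _ _ hDδ, map_sub, map_sub]
    change (θw • δw + (cw - θw) • (1 : Matrix (Fin 3) (Fin 3) (w.1.adicCompletion L))) * ((cw - θ'w) • δw + θ'w • 1)⁻¹ = _
    rw [hδconj, Matrix.coe_units_inv, moebius_conj' _ _ (Matrix.isUnits_det_units P) _ _ _ _ hDι, hφι]
  have hXw : 1 + cw⁻¹ • (δw - 1) = (P : Matrix (Fin 3) (Fin 3) (w.1.adicCompletion L)) * (1 + W) * ((P⁻¹ : GL (Fin 3) (w.1.adicCompletion L)) : Matrix (Fin 3) (Fin 3) (w.1.adicCompletion L)) := by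
    have h1 := smul_units_conj_add_smul_one P ιw cw⁻¹ (1 - cw⁻¹)
    have e2 : cw⁻¹ • ιw + (1 - cw⁻¹) • (1 : Matrix (Fin 3) (Fin 3) (w.1.adicCompletion L)) = 1 + W := by rw [hW, smul_sub, sub_smul, one_smul]; abel
    rw [e2] at h1
    rw [← h1, hδconj, smul_sub, sub_smul, one_smul]
    abel
  -- transport of the three memberships along `P`
  refine ⟨?_, ?_, ?_⟩
  · rw [hYw]
    change _ ∈ Algebra.adjoin O ({1 + cw⁻¹ • (δw - 1)} : Set (Matrix (Fin 3) (Fin 3) (w.1.adicCompletion L)))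
    rw [hXw]
    exact conj_mem_adjoin_of_mem_adjoin O P (mem_adjoin_one_add_of_mem_adjoin O hY₀mem)
  · rw [hYw, units_conj_nonsing_inv P Y₀ (by rw [hY₀, Matrix.det_mul]; exact (by obtain ⟨d, -, hd⟩ := hp; exact IsUnit.of_mul_eq_one_right d hd : IsUnit _).mul (Matrix.isUnit_nonsing_inv_det _ hNu))]
    change _ ∈ Algebra.adjoin O ({1 + cw⁻¹ • (δw - 1)} : Set (Matrix (Fin 3) (Fin 3) (w.1.adicCompletion L)))
    rw [hXw]
    exact conj_mem_adjoin_of_mem_adjoin O P (mem_adjoin_one_add_of_mem_adjoin O hY₀inv)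
  · change 1 + cw⁻¹ • (δw - 1) ∈ Algebra.adjoin O ({((δ'.val : GL (Fin 3) (LocalRing L v)).val.map evw)} : Set (Matrix (Fin 3) (Fin 3) (w.1.adicCompletion L)))
    rw [hXw, hYw]
    exact conj_mem_adjoin_of_mem_adjoin O P (one_add_mem_adjoin_of_mem O hWmem)

/-! ## §3 HEAD: the interior orbital transport along `φ_θ` -/

set_option maxHeartbeats 1600000 in
-- budget only: the statement carries the END fold's CM-place tokens (★ N2 ∕ ★ (U) precedent); no search tactic runs long here.
/-- **N3-θ «THE `hF` SOCKET OF (A3)-θ FOR `(Φ(·, g_int), Φ(·, g′))`** — LEVEL-TWO INTERIOR ORBITAL TRANSPORT along the HERMITIAN Cayley shift, ANY residue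
characteristic: at a non-split unramified `v` (`σ • w = w`) of the CM field `L`, let `γ_H` be `G`-regular and 2-DEEP (`ι_v(γ_H)_w ≡ 1 (mod c_w²)`), `u_H = φ_θ(γ_H)`
componentwise and `G`-regular (`φ_θ = (θ•_ + (c−θ)•1)((c−σθ)•_ + σθ•1)⁻¹`, `σ = conjLocal`, `θ + σθ = 1`, `|θ_w| ≤ 1`), `c_w = ϖ_v` the chart's uniformiser, every class
matching `γ_H` (resp. `u_H`) having COMPACT centraliser; let `g` be an `Ad K`-invariant piece (`K = U(H′)(𝒪_v)` hyperspecial) with INTERIOR VALUES `c′` on the three level-1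
strata and `g′` an `Ad K`-invariant piece supported in `K` with STRATA VALUES `c′` on the residually-unipotent locus.  Then for every `x` matching `γ_H` and `y` with matrix
`φ_θ(x)`:  `Φ(⟦x⟧, 1_{x_w ≡ 1 (ϖ)}·g) = Φ(⟦y⟧, g′)`.  ★ N3 `classOrbitalIntegral_levelOneIndicator_eq_shift` is the σ-fixed pair under `|2|_w = 1`; here: finite unfolding on both sides
(★), ★ p846407 `sum_fixedBy_interior_eq_sum_fixedBy_cayley_relabel` over the θ-memberships (§2), and the value identity via §R-θ `rank_redMat_sub_one_eq_of_hermitianShift`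
(`red((q⁻¹yq)_w) − 1 = N̄(1 − σθ̄·N̄)⁻¹`, `N̄` the residual nilpotent of `q⁻¹xq`; ★ P3 `hermitianMoebius_one_add_smul_eq`).
[cite: Rogawski1990, §4.9 Prop. 4.9.1 p. 55; §4.3 p. 43] [cite: Kottwitz1986BaseChangeUnits, §3] [cite: Laumon1995, Lemma (5.3.2) p. 136] -/
theorem classOrbitalIntegral_levelOneIndicator_eq_hermitianShift (L : Type) [Field L] [NumberField L] [IsCMField L] (H' : Matrix (Fin 3) (Fin 3) L)
    {v : HeightOneSpectrum (𝓞 ↥(maximalRealSubfield L))}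
    (hH' : (H'.map (cmConjRingHom L)).transpose = H') (hdet : H'.det ≠ 0) (w : UnitaryGroup.PlacesOver L v)
    (hw : IsCMField.complexConj L • w.1 = w.1) (hv : Algebra.IsUnramifiedIn (𝓞 L) v.asIdeal)
    [MeasurableSpace ((cmDatum L 3 H').Local v)] [BorelSpace ((cmDatum L 3 H').Local v)]
    [∀ γ : ((cmDatum L 3 H').Local v), MeasurableSpace (((cmDatum L 3 H').Local v) ⧸ Subgroup.centralizer ({γ} : Set ((cmDatum L 3 H').Local v)))]
    [∀ γ : ((cmDatum L 3 H').Local v), BorelSpace (((cmDatum L 3 H').Local v) ⧸ Subgroup.centralizer ({γ} : Set ((cmDatum L 3 H').Local v)))]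
    (νG : Measure ((cmDatum L 3 H').Local v)) [νG.IsHaarMeasure] [νG.IsMulRightInvariant] {mG : OrbitalMeasureFamily ((cmDatum L 3 H').Local v)}
    (hmG : mG.IsCanonical (fun γ => IsRegularElt (γ.val : GL (Fin 3) (UnitaryGroup.LocalRing L v))) νG)
    (c : LocalRing L v)
    (hcw : c w = toPlace v w (HeckeCharacter.uniformizer ↥(maximalRealSubfield L) v : v.adicCompletion ↥(maximalRealSubfield L)))
    (θ : LocalRing L v) (hθ : θ + conjLocal L (IsCMField.complexConj L) v θ = 1) (hθv : Valued.v (θ w) ≤ 1)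
    (γH uH : (cmDatum L 2 (Matrix.of fun i j : Fin 2 => if i.val + j.val + 1 = 2 then (1 : L) else 0)).Local v ×
      (cmDatum L 1 (Matrix.of fun i j : Fin 1 => if i.val + j.val + 1 = 1 then (1 : L) else 0)).Local v)
    (hreg : IsLocalGRegular L v γH) (hreg' : IsLocalGRegular L v uH)
    (h1 : ((uH.1.val : GL (Fin 2) (LocalRing L v)).val : Matrix (Fin 2) (Fin 2) (LocalRing L v)) =
      (θ • ((γH.1.val : GL (Fin 2) (LocalRing L v)).val : Matrix (Fin 2) (Fin 2) (LocalRing L v)) + (c - θ) • 1) *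
        ((c - conjLocal L (IsCMField.complexConj L) v θ) • ((γH.1.val : GL (Fin 2) (LocalRing L v)).val : Matrix (Fin 2) (Fin 2) (LocalRing L v)) + conjLocal L (IsCMField.complexConj L) v θ • 1)⁻¹)
    (h2' : ((uH.2.val : GL (Fin 1) (LocalRing L v)).val : Matrix (Fin 1) (Fin 1) (LocalRing L v)) =
      (θ • ((γH.2.val : GL (Fin 1) (LocalRing L v)).val : Matrix (Fin 1) (Fin 1) (LocalRing L v)) + (c - θ) • 1) *
        ((c - conjLocal L (IsCMField.complexConj L) v θ) • ((γH.2.val : GL (Fin 1) (LocalRing L v)).val : Matrix (Fin 1) (Fin 1) (LocalRing L v)) + conjLocal L (IsCMField.complexConj L) v θ • 1)⁻¹)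
    (hD1 : IsUnit ((c - conjLocal L (IsCMField.complexConj L) v θ) • ((γH.1.val : GL (Fin 2) (LocalRing L v)).val : Matrix (Fin 2) (Fin 2) (LocalRing L v)) + conjLocal L (IsCMField.complexConj L) v θ • (1 : Matrix (Fin 2) (Fin 2) (LocalRing L v))).det)
    (hD2 : IsUnit ((c - conjLocal L (IsCMField.complexConj L) v θ) • ((γH.2.val : GL (Fin 1) (LocalRing L v)).val : Matrix (Fin 1) (Fin 1) (LocalRing L v)) + conjLocal L (IsCMField.complexConj L) v θ • (1 : Matrix (Fin 1) (Fin 1) (LocalRing L v))).det)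
    (hdeep : ∀ i j, Valued.v (((((endoEmbLocal L v γH).val : GL (Fin 3) (LocalRing L v)).val.map
        (Pi.evalRingHom (fun w' : UnitaryGroup.PlacesOver L v => w'.1.adicCompletion L) w)) - 1) i j) ≤ Valued.v (c w) ^ 2)
    (hZ : ∀ x : (cmDatum L 3 H').Local v, IsLocalNormPair L H' v γH x → CompactSpace (Subgroup.centralizer ({x} : Set ((cmDatum L 3 H').Local v))))
    (hZ' : ∀ y : (cmDatum L 3 H').Local v, IsLocalNormPair L H' v uH y → CompactSpace (Subgroup.centralizer ({y} : Set ((cmDatum L 3 H').Local v))))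
    (g : ((cmDatum L 3 H').Local v) → ℂ) (hg : Rogawski1990.IsLocSmooth g) (hgK : tsupport g ⊆ (cmLocalIntegralLevel L 3 H' v : Set ((cmDatum L 3 H').Local v)))
    (hginv : ∀ u ∈ cmLocalIntegralLevel L 3 H' v, ∀ x, g (u * x * u⁻¹) = g x)
    (c' : ℕ → ℂ) (hc' : ((∀ x : ((cmDatum L 3 H').Local v), (x ∈ cmLocalIntegralLevel L 3 H' v ∧ (∀ a b, Valued.v (((toPlace v w (HeckeCharacter.uniformizer ↥(maximalRealSubfield L) v : v.adicCompletion ↥(maximalRealSubfield L))) ^ 1)⁻¹ *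
        ((((localNonsplitEquiv (IsCMField.complexConj L) H' (IsCMField.complexConj_ne_one L) w hw (x) :
            ↥(unitaryGroupOfForm (galAdicCompletionMap (L := L) (IsCMField.complexConj L) hw) (placeForm H' w.1))) : GL (Fin 3) (w.1.adicCompletion L)) :
              Matrix (Fin 3) (Fin 3) (w.1.adicCompletion L)) a b - (1 : Matrix (Fin 3) (Fin 3) (w.1.adicCompletion L)) a b)) ≤ 1) ∧
        (redMat ((toPlace v w (HeckeCharacter.uniformizer ↥(maximalRealSubfield L) v : v.adicCompletion ↥(maximalRealSubfield L)))⁻¹ • ((((x).val : GL (Fin 3) (UnitaryGroup.LocalRing L v)).val.map (Pi.evalRingHom (fun w' : UnitaryGroup.PlacesOver L v => w'.1.adicCompletion L) w)) - 1))) ^ 3 = 0 ∧ (redMat ((toPlace v w (HeckeCharacter.uniformizer ↥(maximalRealSubfield L) v : v.adicCompletion ↥(maximalRealSubfield L)))⁻¹ • ((((x).val : GL (Fin 3) (UnitaryGroup.LocalRing L v)).val.map (Pi.evalRingHom (fun w' : UnitaryGroup.PlacesOver L v => w'.1.adicCompletion L) w)) - 1))).rank = 0) → g x = c' 0) ∧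
      (∀ x : ((cmDatum L 3 H').Local v), (x ∈ cmLocalIntegralLevel L 3 H' v ∧ (∀ a b, Valued.v (((toPlace v w (HeckeCharacter.uniformizer ↥(maximalRealSubfield L) v : v.adicCompletion ↥(maximalRealSubfield L))) ^ 1)⁻¹ *
        ((((localNonsplitEquiv (IsCMField.complexConj L) H' (IsCMField.complexConj_ne_one L) w hw (x) :
            ↥(unitaryGroupOfForm (galAdicCompletionMap (L := L) (IsCMField.complexConj L) hw) (placeForm H' w.1))) : GL (Fin 3) (w.1.adicCompletion L)) :
              Matrix (Fin 3) (Fin 3) (w.1.adicCompletion L)) a b - (1 : Matrix (Fin 3) (Fin 3) (w.1.adicCompletion L)) a b)) ≤ 1) ∧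
        (redMat ((toPlace v w (HeckeCharacter.uniformizer ↥(maximalRealSubfield L) v : v.adicCompletion ↥(maximalRealSubfield L)))⁻¹ • ((((x).val : GL (Fin 3) (UnitaryGroup.LocalRing L v)).val.map (Pi.evalRingHom (fun w' : UnitaryGroup.PlacesOver L v => w'.1.adicCompletion L) w)) - 1))) ^ 3 = 0 ∧ (redMat ((toPlace v w (HeckeCharacter.uniformizer ↥(maximalRealSubfield L) v : v.adicCompletion ↥(maximalRealSubfield L)))⁻¹ • ((((x).val : GL (Fin 3) (UnitaryGroup.LocalRing L v)).val.map (Pi.evalRingHom (fun w' : UnitaryGroup.PlacesOver L v => w'.1.adicCompletion L) w)) - 1))).rank = 1) → g x = c' 1) ∧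
      (∀ x : ((cmDatum L 3 H').Local v), (x ∈ cmLocalIntegralLevel L 3 H' v ∧ (∀ a b, Valued.v (((toPlace v w (HeckeCharacter.uniformizer ↥(maximalRealSubfield L) v : v.adicCompletion ↥(maximalRealSubfield L))) ^ 1)⁻¹ *
        ((((localNonsplitEquiv (IsCMField.complexConj L) H' (IsCMField.complexConj_ne_one L) w hw (x) :
            ↥(unitaryGroupOfForm (galAdicCompletionMap (L := L) (IsCMField.complexConj L) hw) (placeForm H' w.1))) : GL (Fin 3) (w.1.adicCompletion L)) :
              Matrix (Fin 3) (Fin 3) (w.1.adicCompletion L)) a b - (1 : Matrix (Fin 3) (Fin 3) (w.1.adicCompletion L)) a b)) ≤ 1) ∧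
        (redMat ((toPlace v w (HeckeCharacter.uniformizer ↥(maximalRealSubfield L) v : v.adicCompletion ↥(maximalRealSubfield L)))⁻¹ • ((((x).val : GL (Fin 3) (UnitaryGroup.LocalRing L v)).val.map (Pi.evalRingHom (fun w' : UnitaryGroup.PlacesOver L v => w'.1.adicCompletion L) w)) - 1))) ^ 3 = 0 ∧ (redMat ((toPlace v w (HeckeCharacter.uniformizer ↥(maximalRealSubfield L) v : v.adicCompletion ↥(maximalRealSubfield L)))⁻¹ • ((((x).val : GL (Fin 3) (UnitaryGroup.LocalRing L v)).val.map (Pi.evalRingHom (fun w' : UnitaryGroup.PlacesOver L v => w'.1.adicCompletion L) w)) - 1))).rank = 2) → g x = c' 2)))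
    (g' : ((cmDatum L 3 H').Local v) → ℂ) (hg' : Rogawski1990.IsLocSmooth g') (hg'K : tsupport g' ⊆ (cmLocalIntegralLevel L 3 H' v : Set ((cmDatum L 3 H').Local v)))
    (hg'inv : ∀ u ∈ cmLocalIntegralLevel L 3 H' v, ∀ x, g' (u * x * u⁻¹) = g' x)
    (hg'val : ∀ k ∈ cmLocalIntegralLevel L 3 H' v,
        (redMat (((k).val : GL (Fin 3) (UnitaryGroup.LocalRing L v)).val.map (Pi.evalRingHom (fun w' : UnitaryGroup.PlacesOver L v => w'.1.adicCompletion L) w)) - 1) ^ 3 = 0 →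
        g' k = c' (redMat (((k).val : GL (Fin 3) (UnitaryGroup.LocalRing L v)).val.map (Pi.evalRingHom (fun w' : UnitaryGroup.PlacesOver L v => w'.1.adicCompletion L) w)) - 1).rank)
    (x y : (cmDatum L 3 H').Local v) (hx : IsLocalNormPair L H' v γH x)
    (hy : ((y.val : GL (Fin 3) (LocalRing L v)).val : Matrix (Fin 3) (Fin 3) (LocalRing L v)) =
      (θ • ((x.val : GL (Fin 3) (LocalRing L v)).val : Matrix (Fin 3) (Fin 3) (LocalRing L v)) + (c - θ) • 1) *
        ((c - conjLocal L (IsCMField.complexConj L) v θ) • ((x.val : GL (Fin 3) (LocalRing L v)).val : Matrix (Fin 3) (Fin 3) (LocalRing L v)) + conjLocal L (IsCMField.complexConj L) v θ • 1)⁻¹) :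
    classOrbitalIntegral mG ({x : (cmDatum L 3 H').Local v | (∀ a b, Valued.v (((toPlace v w (HeckeCharacter.uniformizer ↥(maximalRealSubfield L) v : v.adicCompletion ↥(maximalRealSubfield L))) ^ 1)⁻¹ *
        ((((localNonsplitEquiv (IsCMField.complexConj L) H' (IsCMField.complexConj_ne_one L) w hw (x) :
            ↥(unitaryGroupOfForm (galAdicCompletionMap (L := L) (IsCMField.complexConj L) hw) (placeForm H' w.1))) : GL (Fin 3) (w.1.adicCompletion L)) :
              Matrix (Fin 3) (Fin 3) (w.1.adicCompletion L)) a b - (1 : Matrix (Fin 3) (Fin 3) (w.1.adicCompletion L)) a b)) ≤ 1)}.indicator g) (ConjClasses.mk x) =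
      classOrbitalIntegral mG g' (ConjClasses.mk y) := by
  classical
  -- §0 the place: one `w` above `v`, the model `e`, `c_w = ϖ_v`
  have hsub : Subsingleton (UnitaryGroup.PlacesOver L v) := PlacesOver.subsingleton_of_smul_eq (IsCMField.complexConj L) (IsCMField.complexConj_ne_one L) w hw
  set evw : LocalRing L v →+* w.1.adicCompletion L := (Pi.evalRingHom (fun w' : UnitaryGroup.PlacesOver L v => w'.1.adicCompletion L) w) with hevw
  set ϖ' : w.1.adicCompletion L := (toPlace v w (HeckeCharacter.uniformizer ↥(maximalRealSubfield L) v : v.adicCompletion ↥(maximalRealSubfield L))) with hϖ'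
  have hϖv : Valued.v ϖ' = WithZero.exp (-1 : ℤ) := Liu2021.LemD1IndexedNonVacuityInertCofinite.valued_toPlace_uniformizer_of_isUnramifiedIn L v hv w
  have hc : Valued.v (c w) = WithZero.exp (-1 : ℤ) := by rw [hcw]; exact hϖv
  obtain ⟨hc0, hc1, hcm, hcp, -, -⟩ := shift_parameter_facts hc
  have hc1' : ValuativeRel.valuation (w.1.adicCompletion L) (c w) < 1 := (v_lt_one_iff_valuation_lt_one _).1 hc1
  -- the pair `(θ_w, θ′_w)`: `θ_w + θ′_w = 1`, both integral
  set θw : w.1.adicCompletion L := θ w with hθw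
  set θ'w : w.1.adicCompletion L := (conjLocal L (IsCMField.complexConj L) v θ) w with hθ'w
  have hsum : θw + θ'w = 1 := by
    have h := congrArg (fun f : LocalRing L v => f w) hθ
    simpa only [Pi.add_apply, Pi.one_apply] using h
  have hθ'v : Valued.v θ'w ≤ 1 := by
    rw [show θ'w = 1 - θw by linear_combination hsum]
    exact (Valuation.map_sub _ _ _).trans (max_le (by rw [map_one]) hθv)
  have hθw1 : ValuativeRel.valuation (w.1.adicCompletion L) θw ≤ 1 := (v_le_one_iff_valuation_le_one _).1 hθv
  have hθ'w1 : ValuativeRel.valuation (w.1.adicCompletion L) θ'w ≤ 1 := (v_le_one_iff_valuation_le_one _).1 hθ'v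
  have hct1 : ValuativeRel.valuation (w.1.adicCompletion L) (c w - θ'w) ≤ 1 :=
    (v_le_one_iff_valuation_le_one _).1 ((Valuation.map_sub _ _ _).trans (max_le hc1.le hθ'v))
  -- §1 regularity, matching of `y` with `u_H`, closed classes, compact centralisers, `K`
  obtain ⟨hD, hN⟩ := isUnit_det_hermitianShift_denominators_of_deep L w hw γH hc hθ hθv hdeep
  have hιu := coe_endoEmbLocal_eq_genMoebius L v γH uH θ (c - θ) (conjLocal L (IsCMField.complexConj L) v θ) (c - conjLocal L (IsCMField.complexConj L) v θ) h1 h2' hD1 hD2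
  have hyu : IsLocalNormPair L H' v uH y := isLocalNormPair_of_coe_eq_genMoebius L v H' γH uH x y θ (c - θ) (conjLocal L (IsCMField.complexConj L) v θ) (c - conjLocal L (IsCMField.complexConj L) v θ) hx hιu hy hD
  have hxreg : IsRegularElt (x.val : GL (Fin 3) (UnitaryGroup.LocalRing L v)) := isRegularElt_of_isLocalNormPair L H' v hx hreg
  have hyreg : IsRegularElt (y.val : GL (Fin 3) (UnitaryGroup.LocalRing L v)) := isRegularElt_of_isLocalNormPair L H' v hyu hreg'
  have hP : ∀ g₀ z : (cmDatum L 3 H').Local v, IsRegularElt (g₀.val : GL (Fin 3) (UnitaryGroup.LocalRing L v)) →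
      IsRegularElt ((z * g₀ * z⁻¹).val : GL (Fin 3) (UnitaryGroup.LocalRing L v)) := fun g₀ z hg₀ => isRegularElt_val_conj L 3 H' v g₀ z hg₀
  have hOx := isClosed_conjClass_local_of_isRegularElt L 3 H' v hH' hdet x hxreg
  have hOy := isClosed_conjClass_local_of_isRegularElt L 3 H' v hH' hdet y hyreg
  haveI := hZ x hx
  haveI := hZ' y hyu
  obtain ⟨hKc, hKo⟩ := isCompact_isOpen_cmLocalIntegralLevel L 3 H' v
  -- §2 the integrands: `g_int = 1_{≡1}·g` and `g′`
  have hgc : Continuous g := hg.1.continuous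
  have hg'c : Continuous g' := hg'.1.continuous
  set S₁ : Set ((cmDatum L 3 H').Local v) := {x : (cmDatum L 3 H').Local v | (∀ a b, Valued.v (((toPlace v w (HeckeCharacter.uniformizer ↥(maximalRealSubfield L) v : v.adicCompletion ↥(maximalRealSubfield L))) ^ 1)⁻¹ *
          ((((localNonsplitEquiv (IsCMField.complexConj L) H' (IsCMField.complexConj_ne_one L) w hw x :
        ↥(unitaryGroupOfForm (galAdicCompletionMap (L := L) (IsCMField.complexConj L) hw) (placeForm H' w.1))) : GL (Fin 3) (w.1.adicCompletion L)) :
          Matrix (Fin 3) (Fin 3) (w.1.adicCompletion L)) a b - (1 : Matrix (Fin 3) (Fin 3) (w.1.adicCompletion L)) a b)) ≤ 1)} with hS₁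
  have hS₁' : S₁ = {U : (cmDatum L 3 H').Local v | IsIntMatrix ((c w)⁻¹ • ((((localNonsplitEquiv (IsCMField.complexConj L) H' (IsCMField.complexConj_ne_one L) w hw U :
        ↥(unitaryGroupOfForm (galAdicCompletionMap (L := L) (IsCMField.complexConj L) hw) (placeForm H' w.1))) : GL (Fin 3) (w.1.adicCompletion L)) :
          Matrix (Fin 3) (Fin 3) (w.1.adicCompletion L)) - 1))} := by
    ext U
    simp only [hS₁, Set.mem_setOf_eq, IsIntMatrix, Matrix.smul_apply, Matrix.sub_apply, smul_eq_mul, pow_one, hcw]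
    exact Iff.rfl
  have hS₁o : IsOpen S₁ := by
    rw [hS₁']
    have h := isOpen_setOf_level L 3 H' (IsCMField.complexConj_ne_one L) w hw hc0 1
    simp only [pow_one] at h
    exact h
  have hS₁cl : IsClosed S₁ := by rw [hS₁']; exact isClosed_setOf_levelOne L H' w hw hc0
  have hgint_c : Continuous (S₁.indicator g) := by
    rw [← Set.piecewise_eq_indicator]
    refine continuous_piecewise (fun a ha => ?_) hgc.continuousOn continuousOn_const
    rw [(IsClopen.frontier_eq ⟨hS₁cl, hS₁o⟩)] at ha
    exact absurd ha (Set.notMem_empty a)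
  have hgint_supp : Function.support (S₁.indicator g) ⊆ (cmLocalIntegralLevel L 3 H' v : Set ((cmDatum L 3 H').Local v)) := by
    rw [Set.support_indicator]
    exact Set.inter_subset_right.trans ((subset_tsupport g).trans hgK)
  have hg'supp : Function.support g' ⊆ (cmLocalIntegralLevel L 3 H' v : Set ((cmDatum L 3 H').Local v)) := (subset_tsupport g').trans hg'K
  have hgint_inv : ∀ k ∈ cmLocalIntegralLevel L 3 H' v, ∀ z : (cmDatum L 3 H').Local v, (S₁.indicator g) (k * z * k⁻¹) = (S₁.indicator g) z := by
    intro k hk z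
    have hmem : k * z * k⁻¹ ∈ S₁ ↔ z ∈ S₁ := by
      rw [hS₁']
      exact isIntMatrix_inv_smul_conj_sub_one_iff L H' w hw (c w) hk z
    by_cases hz : z ∈ S₁
    · rw [Set.indicator_of_mem (hmem.2 hz), Set.indicator_of_mem hz, hginv k hk z]
    · rw [Set.indicator_of_notMem (fun h => hz (hmem.1 h)), Set.indicator_of_notMem hz]
  -- §3 unfold both class orbital integrals over the fixed points on `G′ ⧸ K`
  rw [classOrbitalIntegral_eq_sum_fixedBy_of_support_subset_of_conj_invariant hP hmG hxreg (cmLocalIntegralLevel L 3 H' v) hKo hKc hOx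
      (S₁.indicator g) hgint_c hgint_supp hgint_inv,
    classOrbitalIntegral_eq_sum_fixedBy_of_support_subset_of_conj_invariant hP hmG hyreg (cmLocalIntegralLevel L 3 H' v) hKo hKc hOy
      g' hg'c hg'supp hg'inv]
  congr 1
  -- §4 the order memberships (★ N2′) and the fixed points of `y` = the interior fixed points of `x` (★ p846407)
  obtain ⟨hu, hu', hX⟩ := hermitianShifted_order_memberships_of_deep L H' w hw γH x y hc hθ hθv hdeep hx hy
  have hu'' : (((((localNonsplitEquiv (IsCMField.complexConj L) H' (IsCMField.complexConj_ne_one L) w hw y :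
        ↥(unitaryGroupOfForm (galAdicCompletionMap (L := L) (IsCMField.complexConj L) hw) (placeForm H' w.1))) : GL (Fin 3) (w.1.adicCompletion L)))⁻¹ : GL (Fin 3) (w.1.adicCompletion L)) : Matrix (Fin 3) (Fin 3) (w.1.adicCompletion L)) ∈
      Algebra.adjoin 𝒪[w.1.adicCompletion L] ({1 + (c w)⁻¹ • ((((localNonsplitEquiv (IsCMField.complexConj L) H' (IsCMField.complexConj_ne_one L) w hw x :
        ↥(unitaryGroupOfForm (galAdicCompletionMap (L := L) (IsCMField.complexConj L) hw) (placeForm H' w.1))) : GL (Fin 3) (w.1.adicCompletion L)) :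
          Matrix (Fin 3) (Fin 3) (w.1.adicCompletion L)) - 1)} : Set (Matrix (Fin 3) (Fin 3) (w.1.adicCompletion L))) := by
    rw [Matrix.coe_units_inv]; exact hu'
  have step1 : ∑ᶠ q ∈ MulAction.fixedBy ((cmDatum L 3 H').Local v ⧸ cmLocalIntegralLevel L 3 H' v) x, (S₁.indicator g) (q.out⁻¹ * x * q.out) =
      ∑ᶠ q ∈ {q : (cmDatum L 3 H').Local v ⧸ cmLocalIntegralLevel L 3 H' v |
        q ∈ MulAction.fixedBy ((cmDatum L 3 H').Local v ⧸ cmLocalIntegralLevel L 3 H' v) x ∧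
        IsIntMatrix ((c w)⁻¹ • ((((localNonsplitEquiv (IsCMField.complexConj L) H' (IsCMField.complexConj_ne_one L) w hw (q.out⁻¹ * x * q.out) :
        ↥(unitaryGroupOfForm (galAdicCompletionMap (L := L) (IsCMField.complexConj L) hw) (placeForm H' w.1))) : GL (Fin 3) (w.1.adicCompletion L)) :
          Matrix (Fin 3) (Fin 3) (w.1.adicCompletion L)) - 1))}, g (q.out⁻¹ * x * q.out) := by
    rw [finsum_mem_def, finsum_mem_def]
    refine finsum_congr fun q => ?_
    simp only [Set.indicator_apply, Set.mem_setOf_eq]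
    by_cases hq : q ∈ MulAction.fixedBy ((cmDatum L 3 H').Local v ⧸ cmLocalIntegralLevel L 3 H' v) x
    · by_cases hint : q.out⁻¹ * x * q.out ∈ S₁
      · have hint' := hint
        rw [hS₁', Set.mem_setOf_eq] at hint'
        rw [if_pos hq, if_pos hint, if_pos ⟨hq, hint'⟩]
      · have hint' := hint
        rw [hS₁', Set.mem_setOf_eq] at hint'
        rw [if_pos hq, if_neg hint, if_neg (fun h => hint' h.2)]
    · rw [if_neg hq, if_neg (fun h => hq h.1)]
  rw [step1, sum_fixedBy_interior_eq_sum_fixedBy_cayley_relabel L 3 H' (IsCMField.complexConj_ne_one L) w hw hc0 hc1 x y hu hu'' hX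
    (fun q => g (q.out⁻¹ * x * q.out))]
  -- §5 pointwise on the fixed points of `y`: `g(q⁻¹xq) = c′(rank Ā) = g′(q⁻¹yq)`
  refine finsum_mem_congr rfl fun q hq => ?_
  -- `k := q⁻¹yq ∈ K`, `z := q⁻¹xq ∈ K` with `z_w ≡ 1 (c_w)`
  have hk : q.out⁻¹ * y * q.out ∈ cmLocalIntegralLevel L 3 H' v := by
    have h := (mem_fixedBy_quotient_mk_iff (cmLocalIntegralLevel L 3 H' v) y q.out).1
    rw [QuotientGroup.out_eq'] at h
    exact h hq
  obtain ⟨hzK, hzint⟩ := (conj_mem_and_interior_iff_conj_mem L 3 H' (IsCMField.complexConj_ne_one L) w hw hc0 hc1 x y hu hu'' hX q.out).1 hk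
  -- names: `z = q⁻¹xq`, `k = q⁻¹yq`, their matrices at `w`, `A = c_w⁻¹(z_w − 1)`, `W = c_w⁻¹(ι_w − 1)`
  have hzw : (((localNonsplitEquiv (IsCMField.complexConj L) H' (IsCMField.complexConj_ne_one L) w hw (q.out⁻¹ * x * q.out) :
        ↥(unitaryGroupOfForm (galAdicCompletionMap (L := L) (IsCMField.complexConj L) hw) (placeForm H' w.1))) : GL (Fin 3) (w.1.adicCompletion L)) :
          Matrix (Fin 3) (Fin 3) (w.1.adicCompletion L)) = (((q.out⁻¹ * x * q.out).val : GL (Fin 3) (UnitaryGroup.LocalRing L v)).val.map (Pi.evalRingHom (fun w' : UnitaryGroup.PlacesOver L v => w'.1.adicCompletion L) w)) := rfl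
  have hkw : (((localNonsplitEquiv (IsCMField.complexConj L) H' (IsCMField.complexConj_ne_one L) w hw (q.out⁻¹ * y * q.out) :
        ↥(unitaryGroupOfForm (galAdicCompletionMap (L := L) (IsCMField.complexConj L) hw) (placeForm H' w.1))) : GL (Fin 3) (w.1.adicCompletion L)) :
          Matrix (Fin 3) (Fin 3) (w.1.adicCompletion L)) = (((q.out⁻¹ * y * q.out).val : GL (Fin 3) (UnitaryGroup.LocalRing L v)).val.map (Pi.evalRingHom (fun w' : UnitaryGroup.PlacesOver L v => w'.1.adicCompletion L) w)) := rfl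
  have hAint : IsIntMatrix ((c w)⁻¹ • ((((q.out⁻¹ * x * q.out).val : GL (Fin 3) (UnitaryGroup.LocalRing L v)).val.map (Pi.evalRingHom (fun w' : UnitaryGroup.PlacesOver L v => w'.1.adicCompletion L) w)) - 1)) := by rw [← hzw]; exact hzint
  have hAvb : ValBound 1 ((c w)⁻¹ • ((((q.out⁻¹ * x * q.out).val : GL (Fin 3) (UnitaryGroup.LocalRing L v)).val.map (Pi.evalRingHom (fun w' : UnitaryGroup.PlacesOver L v => w'.1.adicCompletion L) w)) - 1)) := fun i j => (v_le_one_iff_valuation_le_one _).1 (hAint i j)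
  -- (b) `z` matches `γ_H`: `z_w = P ι_w P⁻¹`, so `A = P W P⁻¹` and `charpoly A = charpoly W`
  have hz : IsLocalNormPair L H' v γH (q.out⁻¹ * x * q.out) :=
    isLocalNormPair_of_isConj L v H' γH hx (isConj_iff.2 ⟨q.out⁻¹, by rw [inv_inv]⟩)
  obtain ⟨R, hR⟩ := isConj_iff.1 hz
  have hRdet : IsUnit (((R : GL (Fin 3) (LocalRing L v)) : Matrix (Fin 3) (Fin 3) (LocalRing L v)).map (Pi.evalRingHom (fun w' : UnitaryGroup.PlacesOver L v => w'.1.adicCompletion L) w)).det := by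
    rw [← RingHom.mapMatrix_apply, ← RingHom.map_det]; exact (Matrix.isUnits_det_units R).map _
  set P : GL (Fin 3) (w.1.adicCompletion L) := Matrix.nonsingInvUnit _ hRdet with hP
  have hPv : (P : Matrix (Fin 3) (Fin 3) (w.1.adicCompletion L)) = ((R : GL (Fin 3) (LocalRing L v)) : Matrix (Fin 3) (Fin 3) (LocalRing L v)).map (Pi.evalRingHom (fun w' : UnitaryGroup.PlacesOver L v => w'.1.adicCompletion L) w) := rfl
  have hPi : ((P⁻¹ : GL (Fin 3) (w.1.adicCompletion L)) : Matrix (Fin 3) (Fin 3) (w.1.adicCompletion L)) = ((((R : GL (Fin 3) (LocalRing L v)) : Matrix (Fin 3) (Fin 3) (LocalRing L v)).map (Pi.evalRingHom (fun w' : UnitaryGroup.PlacesOver L v => w'.1.adicCompletion L) w)))⁻¹ := by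
    rw [Matrix.coe_units_inv, hPv]
  have hmz : (((q.out⁻¹ * x * q.out).val : GL (Fin 3) (LocalRing L v)).val : Matrix (Fin 3) (Fin 3) (LocalRing L v)) =
      (R : GL (Fin 3) (LocalRing L v)).val * ((((endoEmbLocal L v γH).val : GL (Fin 3) (LocalRing L v)).val : Matrix (Fin 3) (Fin 3) (LocalRing L v))) * (R⁻¹ : GL (Fin 3) (LocalRing L v)).val := by
    rw [← hR, Units.val_mul, Units.val_mul]; rfl
  have hzconj : (((q.out⁻¹ * x * q.out).val : GL (Fin 3) (UnitaryGroup.LocalRing L v)).val.map (Pi.evalRingHom (fun w' : UnitaryGroup.PlacesOver L v => w'.1.adicCompletion L) w)) = (P : Matrix (Fin 3) (Fin 3) (w.1.adicCompletion L)) * (((endoEmbLocal L v γH).val : GL (Fin 3) (LocalRing L v)).val.map (Pi.evalRingHom (fun w' : UnitaryGroup.PlacesOver L v => w'.1.adicCompletion L) w)) * ((P⁻¹ : GL (Fin 3) (w.1.adicCompletion L)) : Matrix (Fin 3) (Fin 3) (w.1.adicCompletion L)) := by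
    rw [show (((q.out⁻¹ * x * q.out).val : GL (Fin 3) (UnitaryGroup.LocalRing L v)).val.map (Pi.evalRingHom (fun w' : UnitaryGroup.PlacesOver L v => w'.1.adicCompletion L) w)) = ((((q.out⁻¹ * x * q.out).val : GL (Fin 3) (LocalRing L v)).val : Matrix (Fin 3) (Fin 3) (LocalRing L v))).map (Pi.evalRingHom (fun w' : UnitaryGroup.PlacesOver L v => w'.1.adicCompletion L) w) from rfl, hmz, Matrix.map_mul, Matrix.map_mul, Matrix.coe_units_inv,
      map_nonsing_inv_of_isUnit _ _ (Matrix.isUnits_det_units R), hPi, hPv]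
  have hAconj : ((c w)⁻¹ • ((((q.out⁻¹ * x * q.out).val : GL (Fin 3) (UnitaryGroup.LocalRing L v)).val.map (Pi.evalRingHom (fun w' : UnitaryGroup.PlacesOver L v => w'.1.adicCompletion L) w)) - 1)) = (P : Matrix (Fin 3) (Fin 3) (w.1.adicCompletion L)) * ((c w)⁻¹ • ((((endoEmbLocal L v γH).val : GL (Fin 3) (LocalRing L v)).val.map (Pi.evalRingHom (fun w' : UnitaryGroup.PlacesOver L v => w'.1.adicCompletion L) w)) - 1)) * ((P⁻¹ : GL (Fin 3) (w.1.adicCompletion L)) : Matrix (Fin 3) (Fin 3) (w.1.adicCompletion L)) := by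
    have h1 := smul_units_conj_add_smul_one P (((endoEmbLocal L v γH).val : GL (Fin 3) (LocalRing L v)).val.map (Pi.evalRingHom (fun w' : UnitaryGroup.PlacesOver L v => w'.1.adicCompletion L) w)) (c w)⁻¹ (-(c w)⁻¹)
    rw [← hzconj] at h1
    have e1 : (c w)⁻¹ • (((q.out⁻¹ * x * q.out).val : GL (Fin 3) (UnitaryGroup.LocalRing L v)).val.map (Pi.evalRingHom (fun w' : UnitaryGroup.PlacesOver L v => w'.1.adicCompletion L) w)) + (-(c w)⁻¹) • (1 : Matrix (Fin 3) (Fin 3) (w.1.adicCompletion L)) = ((c w)⁻¹ • ((((q.out⁻¹ * x * q.out).val : GL (Fin 3) (UnitaryGroup.LocalRing L v)).val.map (Pi.evalRingHom (fun w' : UnitaryGroup.PlacesOver L v => w'.1.adicCompletion L) w)) - 1)) := by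
      rw [smul_sub, neg_smul, sub_eq_add_neg]
    have e2 : (c w)⁻¹ • (((endoEmbLocal L v γH).val : GL (Fin 3) (LocalRing L v)).val.map (Pi.evalRingHom (fun w' : UnitaryGroup.PlacesOver L v => w'.1.adicCompletion L) w)) + (-(c w)⁻¹) • (1 : Matrix (Fin 3) (Fin 3) (w.1.adicCompletion L)) = ((c w)⁻¹ • ((((endoEmbLocal L v γH).val : GL (Fin 3) (LocalRing L v)).val.map (Pi.evalRingHom (fun w' : UnitaryGroup.PlacesOver L v => w'.1.adicCompletion L) w)) - 1)) := by
      rw [smul_sub, neg_smul, sub_eq_add_neg]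
    rw [← e1, ← e2]; exact h1
  have hchar : (((c w)⁻¹ • ((((q.out⁻¹ * x * q.out).val : GL (Fin 3) (UnitaryGroup.LocalRing L v)).val.map (Pi.evalRingHom (fun w' : UnitaryGroup.PlacesOver L v => w'.1.adicCompletion L) w)) - 1))).charpoly = (((c w)⁻¹ • ((((endoEmbLocal L v γH).val : GL (Fin 3) (LocalRing L v)).val.map (Pi.evalRingHom (fun w' : UnitaryGroup.PlacesOver L v => w'.1.adicCompletion L) w)) - 1))).charpoly := by
    rw [hAconj, Matrix.coe_units_inv]; exact Matrix.charpoly_units_conj P _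
  -- (c) `W` is integral with entries of valuation `< 1` (2-deepness)
  have hWc : ∀ i j, Valued.v ((((c w)⁻¹ • ((((endoEmbLocal L v γH).val : GL (Fin 3) (LocalRing L v)).val.map (Pi.evalRingHom (fun w' : UnitaryGroup.PlacesOver L v => w'.1.adicCompletion L) w)) - 1))) i j) ≤ Valued.v (c w) := by
    intro i j
    rw [Matrix.smul_apply, smul_eq_mul, map_mul, map_inv₀]
    have hvc0 : Valued.v (c w) ≠ 0 := (Valuation.ne_zero_iff _).2 hc0
    calc (Valued.v (c w))⁻¹ * Valued.v (((((endoEmbLocal L v γH).val : GL (Fin 3) (LocalRing L v)).val.map (Pi.evalRingHom (fun w' : UnitaryGroup.PlacesOver L v => w'.1.adicCompletion L) w)) - 1) i j)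
        ≤ (Valued.v (c w))⁻¹ * Valued.v (c w) ^ 2 := mul_le_mul_right (hdeep i j) _
      _ = Valued.v (c w) := by rw [sq, ← mul_assoc, inv_mul_cancel₀ hvc0, one_mul]
  have hWvb : ValBound 1 ((c w)⁻¹ • ((((endoEmbLocal L v γH).val : GL (Fin 3) (LocalRing L v)).val.map (Pi.evalRingHom (fun w' : UnitaryGroup.PlacesOver L v => w'.1.adicCompletion L) w)) - 1)) := fun i j => (v_le_one_iff_valuation_le_one _).1 ((hWc i j).trans hc1.le)
  have hWlt : ∀ i j, ValuativeRel.valuation (w.1.adicCompletion L) ((((c w)⁻¹ • ((((endoEmbLocal L v γH).val : GL (Fin 3) (LocalRing L v)).val.map (Pi.evalRingHom (fun w' : UnitaryGroup.PlacesOver L v => w'.1.adicCompletion L) w)) - 1))) i j) < 1 := fun i j => (v_lt_one_iff_valuation_lt_one _).1 ((hWc i j).trans_lt hc1)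
  -- (d) the residual nilpotent `Ā` of `z` is cube-zero, of rank `< 3`
  have hA3 : redMat ((c w)⁻¹ • ((((q.out⁻¹ * x * q.out).val : GL (Fin 3) (UnitaryGroup.LocalRing L v)).val.map (Pi.evalRingHom (fun w' : UnitaryGroup.PlacesOver L v => w'.1.adicCompletion L) w)) - 1)) ^ 3 = 0 := pow_card_redMat_eq_zero_of_charpoly_eq hAvb hWvb hWlt hchar
  have hrk : (redMat ((c w)⁻¹ • ((((q.out⁻¹ * x * q.out).val : GL (Fin 3) (UnitaryGroup.LocalRing L v)).val.map (Pi.evalRingHom (fun w' : UnitaryGroup.PlacesOver L v => w'.1.adicCompletion L) w)) - 1))).rank < 3 := rank_lt_of_pow_eq_zero hA3 (by norm_num)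
  -- (e) `k_w = φ_{c_w}(z_w)`: on `E_v`, then at `w`, then in terms of `A`
  obtain ⟨hDx, -⟩ := isUnit_det_hermitianShift_denominators_of_isLocalNormPair L v H' c θ γH hD hN hx
  obtain ⟨hDz, -⟩ := isUnit_det_hermitianShift_denominators_of_isLocalNormPair L v H' c θ γH hD hN hz
  have hQdet : IsUnit ((((q.out⁻¹ : (cmDatum L 3 H').Local v).val : GL (Fin 3) (LocalRing L v)).val : Matrix (Fin 3) (Fin 3) (LocalRing L v))).det := Matrix.isUnits_det_units _
  have hQinv : ((((q.out⁻¹ : (cmDatum L 3 H').Local v).val : GL (Fin 3) (LocalRing L v)).val : Matrix (Fin 3) (Fin 3) (LocalRing L v)))⁻¹ = ((q.out.val : GL (Fin 3) (LocalRing L v)).val : Matrix (Fin 3) (Fin 3) (LocalRing L v)) :=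
    Matrix.inv_eq_right_inv (Units.inv_mul ((q.out : (cmDatum L 3 H').Local v).val : GL (Fin 3) (LocalRing L v)))
  have hzmat : (((q.out⁻¹ * x * q.out).val : GL (Fin 3) (LocalRing L v)).val : Matrix (Fin 3) (Fin 3) (LocalRing L v)) = (((q.out⁻¹ : (cmDatum L 3 H').Local v).val : GL (Fin 3) (LocalRing L v)).val : Matrix (Fin 3) (Fin 3) (LocalRing L v)) * ((x.val : GL (Fin 3) (LocalRing L v)).val : Matrix (Fin 3) (Fin 3) (LocalRing L v)) * ((((q.out⁻¹ : (cmDatum L 3 H').Local v).val : GL (Fin 3) (LocalRing L v)).val : Matrix (Fin 3) (Fin 3) (LocalRing L v)))⁻¹ := by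
    rw [hQinv]; rfl
  have hkmat : (((q.out⁻¹ * y * q.out).val : GL (Fin 3) (LocalRing L v)).val : Matrix (Fin 3) (Fin 3) (LocalRing L v)) =
      (θ • (((q.out⁻¹ * x * q.out).val : GL (Fin 3) (LocalRing L v)).val : Matrix (Fin 3) (Fin 3) (LocalRing L v)) + (c - θ) • 1) * ((c - conjLocal L (IsCMField.complexConj L) v θ) • (((q.out⁻¹ * x * q.out).val : GL (Fin 3) (LocalRing L v)).val : Matrix (Fin 3) (Fin 3) (LocalRing L v)) + conjLocal L (IsCMField.complexConj L) v θ • 1)⁻¹ := by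
    have e1 : (((q.out⁻¹ * y * q.out).val : GL (Fin 3) (LocalRing L v)).val : Matrix (Fin 3) (Fin 3) (LocalRing L v)) = (((q.out⁻¹ : (cmDatum L 3 H').Local v).val : GL (Fin 3) (LocalRing L v)).val : Matrix (Fin 3) (Fin 3) (LocalRing L v)) * ((y.val : GL (Fin 3) (LocalRing L v)).val : Matrix (Fin 3) (Fin 3) (LocalRing L v)) * ((((q.out⁻¹ : (cmDatum L 3 H').Local v).val : GL (Fin 3) (LocalRing L v)).val : Matrix (Fin 3) (Fin 3) (LocalRing L v)))⁻¹ := by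
      rw [hQinv]; rfl
    rw [e1, hy, ← moebius_conj' _ _ hQdet _ _ _ _ hDx, ← hzmat]
  have hkw' : (((q.out⁻¹ * y * q.out).val : GL (Fin 3) (UnitaryGroup.LocalRing L v)).val.map (Pi.evalRingHom (fun w' : UnitaryGroup.PlacesOver L v => w'.1.adicCompletion L) w)) =
      (θw • (((q.out⁻¹ * x * q.out).val : GL (Fin 3) (UnitaryGroup.LocalRing L v)).val.map (Pi.evalRingHom (fun w' : UnitaryGroup.PlacesOver L v => w'.1.adicCompletion L) w)) + ((c w) - θw) • (1 : Matrix (Fin 3) (Fin 3) (w.1.adicCompletion L))) *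
        (((c w) - θ'w) • (((q.out⁻¹ * x * q.out).val : GL (Fin 3) (UnitaryGroup.LocalRing L v)).val.map (Pi.evalRingHom (fun w' : UnitaryGroup.PlacesOver L v => w'.1.adicCompletion L) w)) + θ'w • (1 : Matrix (Fin 3) (Fin 3) (w.1.adicCompletion L)))⁻¹ := by
    rw [show (((q.out⁻¹ * y * q.out).val : GL (Fin 3) (UnitaryGroup.LocalRing L v)).val.map (Pi.evalRingHom (fun w' : UnitaryGroup.PlacesOver L v => w'.1.adicCompletion L) w)) = ((((q.out⁻¹ * y * q.out).val : GL (Fin 3) (LocalRing L v)).val : Matrix (Fin 3) (Fin 3) (LocalRing L v))).map (Pi.evalRingHom (fun w' : UnitaryGroup.PlacesOver L v => w'.1.adicCompletion L) w) from rfl, hkmat, map_genMoebius _ _ _ _ _ _ hDz, map_sub, map_sub]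
    rfl
  have hNu : IsUnit ((1 : Matrix (Fin 3) (Fin 3) (w.1.adicCompletion L)) + (c w - θ'w) • ((c w)⁻¹ • ((((q.out⁻¹ * x * q.out).val : GL (Fin 3) (UnitaryGroup.LocalRing L v)).val.map (Pi.evalRingHom (fun w' : UnitaryGroup.PlacesOver L v => w'.1.adicCompletion L) w)) - 1))).det := by
    have h := valuation_det_one_add_smul_eq_one hAvb ⟨3, hA3⟩ hct1
    exact isUnit_iff_ne_zero.2 fun h0 => by rw [h0, map_zero] at h; exact zero_ne_one h
  have hzA : (((q.out⁻¹ * x * q.out).val : GL (Fin 3) (UnitaryGroup.LocalRing L v)).val.map (Pi.evalRingHom (fun w' : UnitaryGroup.PlacesOver L v => w'.1.adicCompletion L) w)) = 1 + (c w) • ((c w)⁻¹ • ((((q.out⁻¹ * x * q.out).val : GL (Fin 3) (UnitaryGroup.LocalRing L v)).val.map (Pi.evalRingHom (fun w' : UnitaryGroup.PlacesOver L v => w'.1.adicCompletion L) w)) - 1)) := eq_one_add_smul_inv_smul_sub_one hc0 _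
  have hMB : (((q.out⁻¹ * y * q.out).val : GL (Fin 3) (UnitaryGroup.LocalRing L v)).val.map (Pi.evalRingHom (fun w' : UnitaryGroup.PlacesOver L v => w'.1.adicCompletion L) w)) * ((1 : Matrix (Fin 3) (Fin 3) (w.1.adicCompletion L)) + (c w - θ'w) • ((c w)⁻¹ • ((((q.out⁻¹ * x * q.out).val : GL (Fin 3) (UnitaryGroup.LocalRing L v)).val.map (Pi.evalRingHom (fun w' : UnitaryGroup.PlacesOver L v => w'.1.adicCompletion L) w)) - 1))) =
      (1 : Matrix (Fin 3) (Fin 3) (w.1.adicCompletion L)) + θw • ((c w)⁻¹ • ((((q.out⁻¹ * x * q.out).val : GL (Fin 3) (UnitaryGroup.LocalRing L v)).val.map (Pi.evalRingHom (fun w' : UnitaryGroup.PlacesOver L v => w'.1.adicCompletion L) w)) - 1)) := by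
    have h := hermitianMoebius_one_add_smul_eq ((c w)⁻¹ • ((((q.out⁻¹ * x * q.out).val : GL (Fin 3) (UnitaryGroup.LocalRing L v)).val.map (Pi.evalRingHom (fun w' : UnitaryGroup.PlacesOver L v => w'.1.adicCompletion L) w)) - 1)) hc0 θw θ'w hNu
    rw [← hzA] at h
    rw [hkw', h, Matrix.nonsing_inv_mul_cancel_right _ _ hNu]
  -- (f) the residual class of `k`: nilpotent of the same rank
  have hkvb : ValBound 1 (((q.out⁻¹ * y * q.out).val : GL (Fin 3) (UnitaryGroup.LocalRing L v)).val.map (Pi.evalRingHom (fun w' : UnitaryGroup.PlacesOver L v => w'.1.adicCompletion L) w)) := by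
    have h := ((mem_cmLocalIntegralLevel_iff_isIntMatrix L 3 H' (IsCMField.complexConj_ne_one L) w hw _).1 hk).1
    rw [hkw] at h
    exact fun i j => (v_le_one_iff_valuation_le_one _).1 (h i j)
  have hk3 : (redMat (((q.out⁻¹ * y * q.out).val : GL (Fin 3) (UnitaryGroup.LocalRing L v)).val.map (Pi.evalRingHom (fun w' : UnitaryGroup.PlacesOver L v => w'.1.adicCompletion L) w)) - 1) ^ 3 = 0 := pow_redMat_sub_one_eq_zero_of_hermitianShift hkvb hAvb hA3 hc1' hθw1 hθ'w1 hsum hMB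
  have hrank : (redMat (((q.out⁻¹ * y * q.out).val : GL (Fin 3) (UnitaryGroup.LocalRing L v)).val.map (Pi.evalRingHom (fun w' : UnitaryGroup.PlacesOver L v => w'.1.adicCompletion L) w)) - 1).rank = (redMat ((c w)⁻¹ • ((((q.out⁻¹ * x * q.out).val : GL (Fin 3) (UnitaryGroup.LocalRing L v)).val.map (Pi.evalRingHom (fun w' : UnitaryGroup.PlacesOver L v => w'.1.adicCompletion L) w)) - 1))).rank :=
    rank_redMat_sub_one_eq_of_hermitianShift hkvb hAvb ⟨3, hA3⟩ hc1' hθw1 hθ'w1 hsum hMB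
  -- (g) the values
  have hg'k : g' (q.out⁻¹ * y * q.out) = c' (redMat (((q.out⁻¹ * y * q.out).val : GL (Fin 3) (UnitaryGroup.LocalRing L v)).val.map (Pi.evalRingHom (fun w' : UnitaryGroup.PlacesOver L v => w'.1.adicCompletion L) w)) - 1).rank := hg'val _ hk hk3
  have hlev : ∀ a b, Valued.v ((ϖ' ^ 1)⁻¹ * ((((localNonsplitEquiv (IsCMField.complexConj L) H' (IsCMField.complexConj_ne_one L) w hw (q.out⁻¹ * x * q.out) :
        ↥(unitaryGroupOfForm (galAdicCompletionMap (L := L) (IsCMField.complexConj L) hw) (placeForm H' w.1))) : GL (Fin 3) (w.1.adicCompletion L)) :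
          Matrix (Fin 3) (Fin 3) (w.1.adicCompletion L)) a b - (1 : Matrix (Fin 3) (Fin 3) (w.1.adicCompletion L)) a b)) ≤ 1 := by
    intro a b
    have h := hzint a b
    rw [Matrix.smul_apply, Matrix.sub_apply, smul_eq_mul, hcw] at h
    rwa [pow_one]
  have hA3' : redMat (ϖ'⁻¹ • ((((q.out⁻¹ * x * q.out).val : GL (Fin 3) (UnitaryGroup.LocalRing L v)).val.map (Pi.evalRingHom (fun w' : UnitaryGroup.PlacesOver L v => w'.1.adicCompletion L) w)) - 1)) ^ 3 = 0 := by rw [← hcw]; exact hA3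
  have hgz : g (q.out⁻¹ * x * q.out) = c' (redMat (ϖ'⁻¹ • ((((q.out⁻¹ * x * q.out).val : GL (Fin 3) (UnitaryGroup.LocalRing L v)).val.map (Pi.evalRingHom (fun w' : UnitaryGroup.PlacesOver L v => w'.1.adicCompletion L) w)) - 1))).rank := by
    obtain ⟨h0, h1c, h2c⟩ := hc'
    have hrk' : (redMat (ϖ'⁻¹ • ((((q.out⁻¹ * x * q.out).val : GL (Fin 3) (UnitaryGroup.LocalRing L v)).val.map (Pi.evalRingHom (fun w' : UnitaryGroup.PlacesOver L v => w'.1.adicCompletion L) w)) - 1))).rank < 3 := by rw [← hcw]; exact hrk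
    generalize hr : (redMat (ϖ'⁻¹ • ((((q.out⁻¹ * x * q.out).val : GL (Fin 3) (UnitaryGroup.LocalRing L v)).val.map (Pi.evalRingHom (fun w' : UnitaryGroup.PlacesOver L v => w'.1.adicCompletion L) w)) - 1))).rank = r at hrk' ⊢
    interval_cases r
    · exact h0 _ ⟨hzK, hlev, hA3', hr⟩
    · exact h1c _ ⟨hzK, hlev, hA3', hr⟩
    · exact h2c _ ⟨hzK, hlev, hA3', hr⟩
  rw [hgz, hg'k, hrank, hcw]

end Literature.NumberTheory.Automorphic

end
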